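import Literature.NumberTheory.LFunctions.FreitasLiHalfPlanesProofs
import HarnessLib

/-!
# [Voros2018] §2.3 eq. (LIR): `Λ_n = Σ*_ρ F_n(ρ)` — proof

LABEL (line 1): **RH-FREE** (theorems only; no definitions, no named facts, no hypothesis on the zeros
of `ζ`).  bears_on: LADDER-RH L-C/L-P (COLUMN 4, LI) — corpus bookkeeping only (Voros's discretized
Keiper sequence).  WHAT THIS IS NOT: an expression of `Λ_n` as a symmetric sum over the zeros is
transcription of a printed identity; Voros's Li-type criterion `RH ⇔ Λ_n > 0 ∀n` stays a CONJECTURE of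
the source (§3.4) and is not touched; nothing here bears on the truth of RH.

Discharges the named fact `Literature.NumberTheory.LFunctions.Voros2018_eqLIR` of
`KeiperLiAsymptoticCriteria.lean` (typed by rh-crit-dbl-t13): for `n ≥ 1`,

  `lim_{T → ∞} Σ_{ρ ∈ liZeroBox T} m(ρ) F_n(ρ) = Λ_n`,

`F_n(x) = (−1)ⁿ[−A_{n0}^{−1} log(x−1) + Σ_{m=0}^{n} (−1)^m A_{nm} log(x−2m)]` (`vorosF`, principal
logarithms), `Λ_n = (−1)ⁿ Σ_{m=1}^{n} (−1)^m A_{nm} log 2ξ(2m)` (`vorosLambda`).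

Source: A. Voros, *Discretized Keiper/Li approach to the Riemann Hypothesis*, Exp. Math. 29 (2020) =
arXiv:1703.02844v3 [Voros2018], §2.3 eq. (LIR), p. 6 (materialised text p0006:L46–78: «the `Λ_n` are
expressible by summations over the zeros (which converge like `Σ_ρ 1/ρ` for any `n`, hence need the rule
(SG)): `Λ_n ≡ Σ_ρ F_n(ρ)`, `n = 1,2,…`»; «Proof (outlined): … integrated by parts … each [zero]
contributes `F_n(ρ)` … `⟨F_n(x)⟩ = O(1/x²)` …»).

## Proof (road taken)

The printed outline pushes a contour to infinity.  We take the equivalent and shorter road already paved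
in the tree — the Hadamard product of `ξ` over the pairs `{ρ_k, 1−ρ_k}` (`RiemannXiHadamardProduct.lean`:
`ξ(s)/ξ(½) = Π_k (1 − b_k(2s−1)²)`, `1 − b_k(2s−1)² = −4b_k (s−ρ_k)(s−(1−ρ_k))`), exactly as the
tree proves Keiper–Li's `λ_n = Σ*_ρ [1 − (1−1/ρ)ⁿ]` (`keiperLiCoeff_eq_zero_sum_holds`):

1. `F_n(x) = Σ_p c_p log(x − p)` over the poles `p ∈ {1, 0, 2, …, 2n}` of `f_n`, with `Σ_p c_p = 0`
   ([Voros2018] (AID), tree `Voros2018_eqAID_holds`: «single-valuedness … the logarithmic coefficients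
   sum to zero»).  Hence `Re F_n(ρ) + Re F_n(1−ρ) = Σ_p c_p log|(p−ρ)(p−(1−ρ))| =
   Σ_p c_p log|1 − b_k(2p−1)²|` for the pair `{ρ, 1−ρ} = {ρ_k, 1−ρ_k}` (the factor `|4b_k|` drops out).
2. `Σ_k log|1 − b_k(2p−1)²| = log|ξ(p)/ξ(½)|` at each pole (`hasSum_log_norm_factors`; `ξ(p) ≠ 0` for
   real `p`), so `Σ_k [Re F_n(ρ_k) + Re F_n(1−ρ_k)] = Σ_p c_p log|ξ(p)| = Λ_n` (using `ξ(0) = ξ(1) = ½`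
   for the tree's `ξ`, i.e. `log 2ξ(0) = log 2ξ(1) = 0`, and `Σ_p c_p = 0` once more).
3. The box sums `Σ_{ρ ∈ liZeroBox T} m(ρ) F_n(ρ)` are REAL (the box is conjugation-stable,
   `m(ρ̄) = m(ρ)`, `F_n(x̄) = conj F_n(x)` off the real axis), so they equal the box sums of
   `m(ρ) Re F_n(ρ)`, which are the truncations `|Im ρ_k| ≤ T` of the series in 2
   (`finsum_liZeroBox_eq_sum`) and converge to its sum (`tendsto_sum_truncation`).

## References

* A. Voros, Exp. Math. 29 (2020); arXiv:1703.02844v3, §2.3 eq. (LIR) p. 6. [Voros2018]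
* X.-J. Li, J. Number Theory 65 (1997), eq. (1.4) (the model `λ_n = Σ*_ρ [1 − (1−1/ρ)ⁿ]`). [Li1997]
-/

noncomputable section

open Complex Filter Topology Set
open scoped Nat ComplexConjugate

namespace Literature.NumberTheory.LFunctions

open IsHadamardSeq

/-! ## Conjugation symmetry of the box sums -/

/-- For `F` with `F(ρ̄) = conj F(ρ)` at the zeros of `ξ`, the box sums `Σ_{ρ ∈ liZeroBox T} m(ρ) F(ρ)`
are real (the box is conjugation-stable, `m(ρ̄) = m(ρ)`); the tree's `conj_finsum_liZeroBox` is the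
case `F(ρ) = 1 − (1−1/ρ)ⁿ`. [folklore] -/
private theorem conj_finsum_liZeroBox_of {F : ℂ → ℂ}
    (hF : ∀ ρ : ℂ, riemannXi ρ = 0 → F (conj ρ) = conj (F ρ)) (T : ℝ) :
    conj (∑ᶠ ρ ∈ liZeroBox T, (riemannZetaZeroOrder ρ : ℂ) * F ρ) =
      ∑ᶠ ρ ∈ liZeroBox T, (riemannZetaZeroOrder ρ : ℂ) * F ρ := by
  classical
  rw [finsum_mem_eq_finite_toFinset_sum _ (liZeroBox_finite T), map_sum]
  set B := (liZeroBox_finite T).toFinset with hB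
  have hmem : ∀ ρ, ρ ∈ B ↔ ρ ∈ liZeroBox T := fun ρ ↦ Set.Finite.mem_toFinset _
  have hterm : ∀ ρ ∈ B, conj ((riemannZetaZeroOrder ρ : ℂ) * F ρ) =
      (riemannZetaZeroOrder (conj ρ) : ℂ) * F (conj ρ) := by
    intro ρ hρ
    rw [riemannZetaZeroOrder_conj_holds ρ, map_mul, map_intCast,
      hF ρ (riemannXi_eq_zero_of_mem_liZeroBox ((hmem ρ).1 hρ))]
  rw [Finset.sum_congr rfl hterm]
  exact Finset.sum_nbij' (fun ρ ↦ conj ρ) (fun ρ ↦ conj ρ)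
    (fun ρ hρ ↦ (hmem _).2 (conj_mem_liZeroBox ((hmem ρ).1 hρ)))
    (fun ρ hρ ↦ (hmem _).2 (conj_mem_liZeroBox ((hmem ρ).1 hρ)))
    (fun ρ _ ↦ Complex.conj_conj ρ) (fun ρ _ ↦ Complex.conj_conj ρ) fun ρ _ ↦ rfl

/-- `log z̄ = conj log z` off the real axis. [folklore] -/
private theorem log_conj_of_im_ne_zero {z : ℂ} (hz : z.im ≠ 0) :
    Complex.log (conj z) = conj (Complex.log z) :=
  Complex.log_conj z fun h ↦ hz (Complex.arg_eq_pi_iff.1 h).2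

/-- `F_n(x̄) = conj F_n(x)` off the real axis (principal logarithms of `x − p`, `p` real).
[cite: Voros2018, §2.3 eq. (Fdef) p.6] -/
private theorem vorosF_conj (n : ℕ) {x : ℂ} (hx : x.im ≠ 0) : vorosF n (conj x) = conj (vorosF n x) := by
  have h1 : Complex.log (conj x - 1) = conj (Complex.log (x - 1)) := by
    rw [show conj x - 1 = conj (x - 1) by rw [map_sub, map_one], log_conj_of_im_ne_zero (by simpa using hx)]
  have h2 : ∀ m : ℕ, Complex.log (conj x - 2 * (m : ℂ)) = conj (Complex.log (x - 2 * (m : ℂ))) := by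
    intro m
    rw [show conj x - 2 * (m : ℂ) = conj (x - 2 * (m : ℂ)) by
      rw [map_sub, map_mul, map_natCast, map_ofNat], log_conj_of_im_ne_zero (by simpa using hx)]
  simp only [vorosF, map_mul, map_add, map_neg, map_sum, map_pow, map_one, map_div₀, map_neg,
    Complex.conj_ofReal, h1, h2]

/-! ## The coefficients of `F_n` and its real part -/

/-- `F_n` with real-cast coefficients: `F_n(x) = a₁ log(x−1) + Σ_m a_m log(x−2m)`,
`a₁ = −(−1)ⁿ/A_{n0}`, `a_m = (−1)^{n+m} A_{nm}`. [cite: Voros2018, §2.3 eq. (Fdef) p.6] -/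
private theorem vorosF_eq (n : ℕ) (x : ℂ) :
    vorosF n x = (((-1 : ℝ) ^ n * (-(1 / vorosA n 0)) : ℝ) : ℂ) * Complex.log (x - 1) +
      ∑ m ∈ Finset.range (n + 1), (((-1 : ℝ) ^ n * ((-1) ^ m * vorosA n m) : ℝ) : ℂ) *
        Complex.log (x - 2 * (m : ℂ)) := by
  simp only [vorosF]
  push_cast
  rw [mul_add, Finset.mul_sum]
  congr 1
  · ring
  · exact Finset.sum_congr rfl fun m _ ↦ by ring

/-- `Re F_n(x) = a₁ log|x−1| + Σ_m a_m log|x−2m|`. [cite: Voros2018, §2.3 eq. (Fdef) p.6] -/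
private theorem re_vorosF (n : ℕ) (x : ℂ) :
    (vorosF n x).re = (-1 : ℝ) ^ n * (-(1 / vorosA n 0)) * Real.log ‖x - 1‖ +
      ∑ m ∈ Finset.range (n + 1), (-1 : ℝ) ^ n * ((-1) ^ m * vorosA n m) * Real.log ‖x - 2 * (m : ℂ)‖ := by
  rw [vorosF_eq, Complex.add_re, Complex.re_sum, Complex.re_ofReal_mul, Complex.log_re]
  congr 1
  exact Finset.sum_congr rfl fun m _ ↦ by rw [Complex.re_ofReal_mul, Complex.log_re]

/-- The logarithmic coefficients of `F_n` sum to zero: `a₁ + Σ_{m=0}^{n} a_m = 0` (by (AID),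
`Σ_m (−1)^m A_{nm} = 1/A_{n0}`; «single-valuedness in the whole `x`-plane minus the cut `[0,2n]`»).
[cite: Voros2018, §2.1 eq. (AID) p.5] -/
private theorem vorosF_coeff_sum {n : ℕ} (hn : 1 ≤ n) :
    (-1 : ℝ) ^ n * (-(1 / vorosA n 0)) +
      ∑ m ∈ Finset.range (n + 1), (-1 : ℝ) ^ n * ((-1) ^ m * vorosA n m) = 0 := by
  rw [← Finset.mul_sum, (Voros2018_eqAID_holds n hn).1]
  ring

/-- `ξ` does not vanish at real points (a zero of `ξ` is off the real axis). [folklore] -/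
private theorem riemannXi_ofReal_ne_zero' (p : ℝ) : riemannXi (p : ℂ) ≠ 0 :=
  fun h ↦ (riemannXi_zero_prop h).2.2.2 (Complex.ofReal_im p)

/-- **The pair identity**: for a Hadamard index `k` with `b_k ≠ 0` and a real point `p`,
`log|1 − b_k(2p−1)²| = log|4b_k| + log|ρ_k − p| + log|(1−ρ_k) − p|`. [folklore] -/
private theorem log_norm_factor_eq {b : ℕ → ℂ} (hb : IsHadamardSeq 0 b) {k : ℕ} (hk : b k ≠ 0)
    (p : ℝ) :
    Real.log ‖1 - b k * (2 * (p : ℂ) - 1) ^ 2‖ =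
      Real.log ‖4 * b k‖ + Real.log ‖xiZero b k - p‖ + Real.log ‖(1 - xiZero b k) - p‖ := by
  have hρ := riemannXi_zero_prop (hb.riemannXi_xiZero hk)
  have him : (xiZero b k).im ≠ 0 := hρ.2.2.2
  have hne1 : xiZero b k - (p : ℂ) ≠ 0 := by
    intro e; apply him
    have := congrArg Complex.im e
    simpa using this
  have hne2 : (1 - xiZero b k) - (p : ℂ) ≠ 0 := by
    intro e; apply him
    have := congrArg Complex.im e
    simpa using this
  have hb4 : (4 : ℂ) * b k ≠ 0 := mul_ne_zero (by norm_num) hk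
  rw [factor_eq_mul b hk, show -4 * b k * (((p : ℂ) - xiZero b k) * ((p : ℂ) - (1 - xiZero b k))) =
      (-(4 * b k)) * ((xiZero b k - p) * ((1 - xiZero b k) - p)) by ring,
    norm_mul (-(4 * b k)), norm_neg, norm_mul (xiZero b k - (p : ℂ)),
    Real.log_mul (norm_ne_zero_iff.2 hb4)
      (mul_ne_zero (norm_ne_zero_iff.2 hne1) (norm_ne_zero_iff.2 hne2)),
    Real.log_mul (norm_ne_zero_iff.2 hne1) (norm_ne_zero_iff.2 hne2), add_assoc]

/-! ## The discharge -/

/-- **[Voros2018] §2.3 eq. (LIR) — DISCHARGED**: for `n ≥ 1`,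
`Λ_n = lim_{T→∞} Σ_{ρ ∈ liZeroBox T} m(ρ) F_n(ρ)` (the sum over the non-trivial zeros with multiplicity,
ordered symmetrically).  Proof by the Hadamard product of `ξ` over the pairs `{ρ_k, 1−ρ_k}` (see the
module docstring): the box sums are real, equal to the truncations of
`Σ_k Σ_p c_p log|1 − b_k(2p−1)²|`, whose sum is `Σ_p c_p log|ξ(p)/ξ(½)| = Λ_n` since `Σ_p c_p = 0` (AID)
and `ξ(0) = ξ(1) = ½`. [cite: Voros2018, §2.3 eq. (LIR) p.6] -/
theorem Voros2018_eqLIR_holds : Voros2018_eqLIR := by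
  intro n hn
  classical
  obtain ⟨b, hb⟩ := exists_isHadamardSeq 0
  -- coefficients
  set a₁ : ℝ := (-1 : ℝ) ^ n * (-(1 / vorosA n 0)) with ha₁
  set a : ℕ → ℝ := fun m ↦ (-1 : ℝ) ^ n * ((-1) ^ m * vorosA n m) with ha
  have hsum0 : a₁ + ∑ m ∈ Finset.range (n + 1), a m = 0 := vorosF_coeff_sum hn
  -- the real part of `F_n`
  set R : ℂ → ℝ := fun x ↦ a₁ * Real.log ‖x - 1‖ +
    ∑ m ∈ Finset.range (n + 1), a m * Real.log ‖x - 2 * (m : ℂ)‖ with hR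
  have hRe : ∀ x, (vorosF n x).re = R x := fun x ↦ re_vorosF n x
  -- the summands over the Hadamard indices
  set G : ℕ → ℝ := fun k ↦ a₁ * Real.log ‖1 - b k * (2 * ((1 : ℝ) : ℂ) - 1) ^ 2‖ +
    ∑ m ∈ Finset.range (n + 1), a m * Real.log ‖1 - b k * (2 * ((2 * m : ℝ) : ℂ) - 1) ^ 2‖ with hG
  set D : ℝ := a₁ * Real.log ‖riemannXi ((1 : ℝ) : ℂ) / riemannXi (1 / 2)‖ +
    ∑ m ∈ Finset.range (n + 1), a m * Real.log ‖riemannXi ((2 * m : ℝ) : ℂ) / riemannXi (1 / 2)‖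
    with hD
  have hGD : HasSum G D := by
    refine ((hb.hasSum_log_norm_factors (riemannXi_ofReal_ne_zero' 1)).mul_left a₁).add ?_
    exact hasSum_sum fun m _ ↦ (hb.hasSum_log_norm_factors (riemannXi_ofReal_ne_zero' _)).mul_left (a m)
  have hG0 : ∀ k, b k = 0 → (G k : ℂ) = 0 := by
    intro k hk
    simp [hG, hk]
  -- `G k = R(ρ_k) + R(1 − ρ_k)` for the genuine indices
  have hGR : ∀ k, b k ≠ 0 → G k = R (xiZero b k) + R (1 - xiZero b k) := by
    intro k hk
    simp only [hG, hR]
    rw [log_norm_factor_eq hb hk 1]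
    simp_rw [log_norm_factor_eq hb hk (2 * _)]
    have e1 : ‖(1 : ℂ) - xiZero b k - ((1 : ℝ) : ℂ)‖ = ‖1 - xiZero b k - 1‖ := by push_cast; ring_nf
    have e2 : ‖xiZero b k - ((1 : ℝ) : ℂ)‖ = ‖xiZero b k - 1‖ := by push_cast; ring_nf
    have e3 : ∀ m : ℕ, ‖xiZero b k - ((2 * m : ℝ) : ℂ)‖ = ‖xiZero b k - 2 * (m : ℂ)‖ := fun m ↦ by
      push_cast; ring_nf
    have e4 : ∀ m : ℕ, ‖1 - xiZero b k - ((2 * m : ℝ) : ℂ)‖ = ‖1 - xiZero b k - 2 * (m : ℂ)‖ := fun m ↦ by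
      push_cast; ring_nf
    simp only [e1, e2, e3, e4]
    have hsplit : ∑ m ∈ Finset.range (n + 1), a m * (Real.log ‖4 * b k‖ + Real.log ‖xiZero b k - 2 * (m : ℂ)‖ +
        Real.log ‖1 - xiZero b k - 2 * (m : ℂ)‖) =
        (∑ m ∈ Finset.range (n + 1), a m) * Real.log ‖4 * b k‖ +
          (∑ m ∈ Finset.range (n + 1), a m * Real.log ‖xiZero b k - 2 * (m : ℂ)‖ +
            ∑ m ∈ Finset.range (n + 1), a m * Real.log ‖1 - xiZero b k - 2 * (m : ℂ)‖) := by
      rw [Finset.sum_mul, ← Finset.sum_add_distrib, ← Finset.sum_add_distrib]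
      exact Finset.sum_congr rfl fun m _ ↦ by ring
    rw [hsplit]
    have hz : (a₁ + ∑ m ∈ Finset.range (n + 1), a m) * Real.log ‖4 * b k‖ = 0 := by
      rw [hsum0, zero_mul]
    linear_combination hz
  -- truncations
  set K : ℝ → Finset ℕ := fun T ↦ (hb.finite_setOf_abs_im_xiZero_le T).toFinset with hKdef
  have hK : ∀ T k, k ∈ K T ↔ b k ≠ 0 ∧ |(xiZero b k).im| ≤ T := fun T k ↦ by
    simp [hKdef, Set.Finite.mem_toFinset]
  have hlim : Tendsto (fun T ↦ ∑ k ∈ K T, (G k : ℂ)) atTop (𝓝 (D : ℂ)) :=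
    tendsto_sum_truncation (Complex.hasSum_ofReal.2 hGD) hG0 K hK
  -- the box sums are the truncations
  have hbox : ∀ T, ∑ᶠ ρ ∈ liZeroBox T, (riemannZetaZeroOrder ρ : ℂ) * vorosF n ρ =
      ∑ k ∈ K T, (G k : ℂ) := by
    intro T
    -- the box sum is real …
    set S := ∑ᶠ ρ ∈ liZeroBox T, (riemannZetaZeroOrder ρ : ℂ) * vorosF n ρ with hS
    have hreal : conj S = S :=
      conj_finsum_liZeroBox_of (fun ρ hρ ↦ vorosF_conj n (riemannXi_zero_prop hρ).2.2.2) T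
    have hSre : S = ((S.re : ℝ) : ℂ) := (Complex.conj_eq_iff_re.1 hreal).symm
    -- … and its real part is the box sum of `m(ρ) Re F_n(ρ)`
    have hre_sum : ((S.re : ℝ) : ℂ) = ∑ᶠ ρ ∈ liZeroBox T, (riemannZetaZeroOrder ρ : ℂ) * ((R ρ : ℝ) : ℂ) := by
      rw [hS, finsum_mem_eq_finite_toFinset_sum _ (liZeroBox_finite T),
        finsum_mem_eq_finite_toFinset_sum _ (liZeroBox_finite T), Complex.re_sum]
      push_cast
      refine Finset.sum_congr rfl fun ρ _ ↦ ?_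
      rw [← hRe ρ, ← Complex.ofReal_intCast, Complex.re_ofReal_mul]
      push_cast
      rfl
    rw [hSre, hre_sum, hb.finsum_liZeroBox_eq_sum (fun ρ ↦ ((R ρ : ℝ) : ℂ)) T (K T) (hK T)]
    refine Finset.sum_congr rfl fun k hk ↦ ?_
    rw [hGR k ((hK T k).1 hk).1]
    push_cast
    rfl
  -- the value `D = Λ_n`
  have hDval : D = vorosLambda n := by
    have hL : ∀ s : ℂ, riemannXi s ≠ 0 → Real.log ‖riemannXi s / riemannXi (1 / 2)‖ =
        Real.log ‖riemannXi s‖ - Real.log ‖riemannXi (1 / 2)‖ := by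
      intro s hs
      rw [norm_div, Real.log_div (norm_ne_zero_iff.2 hs) (norm_ne_zero_iff.2 riemannXi_one_half_ne_zero)]
    set L := Real.log ‖riemannXi (1 / 2)‖ with hLdef
    have h1 : Real.log ‖riemannXi ((1 : ℝ) : ℂ)‖ = Real.log (1 / 2) := by
      rw [Complex.ofReal_one, riemannXi_one]; norm_num
    have h0 : Real.log ‖riemannXi ((2 * (0 : ℕ) : ℝ) : ℂ)‖ = Real.log (1 / 2) := by
      rw [show ((2 * (0 : ℕ) : ℝ) : ℂ) = 0 by push_cast; ring, riemannXi_zero]; norm_num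
    -- positivity of `ξ(2m)`: `Re ξ(2m) = |ξ(2m)| > 0`
    have hpos : ∀ m : ℕ, (riemannXi (2 * (m : ℂ))).re = ‖riemannXi ((2 * m : ℝ) : ℂ)‖ ∧
        0 < (riemannXi (2 * (m : ℂ))).re := by
      intro m
      have hp := riemannXi_ofReal_pos (2 * m : ℝ)
      obtain ⟨hre, him⟩ := Complex.pos_iff.1 hp
      have e : ((2 * m : ℝ) : ℂ) = 2 * (m : ℂ) := by push_cast; ring
      rw [e] at hre him
      refine ⟨?_, hre⟩
      rw [e, ← Complex.re_add_im (riemannXi (2 * (m : ℂ))), ← him]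
      simp [abs_of_pos hre]
    -- rewrite `D`
    have hD' : D = a₁ * (Real.log (1 / 2) - L) +
        ∑ m ∈ Finset.range (n + 1), a m * (Real.log ‖riemannXi ((2 * m : ℝ) : ℂ)‖ - L) := by
      rw [hD, hL _ (riemannXi_ofReal_ne_zero' 1), h1]
      congr 1
      exact Finset.sum_congr rfl fun m _ ↦ by rw [hL _ (riemannXi_ofReal_ne_zero' _)]
    rw [hD', Finset.sum_range_succ' _ n, h0]
    -- `Λ_n` over `Icc 1 n` as a sum over `range n`
    have hΛ : vorosLambda n = ∑ m ∈ Finset.range n, a (m + 1) *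
        (Real.log 2 + Real.log ‖riemannXi ((2 * (m + 1 : ℕ) : ℝ) : ℂ)‖) := by
      unfold vorosLambda
      rw [← Finset.Ico_add_one_right_eq_Icc, Finset.sum_Ico_eq_sum_range, Nat.add_sub_cancel,
        Finset.mul_sum]
      refine Finset.sum_congr rfl fun m _ ↦ ?_
      obtain ⟨hre, hposm⟩ := hpos (1 + m)
      rw [show (2 * ((1 + m : ℕ) : ℂ)) = 2 * (((1 + m : ℕ) : ℂ)) from rfl, hre,
        Real.log_mul two_ne_zero (by rw [← hre]; exact hposm.ne'), show m + 1 = 1 + m by ring, ha]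
      ring
    rw [hΛ]
    -- compare using `a₁ + a 0 + Σ_{m<n} a (m+1) = 0`
    have hsum1 : a₁ + a 0 + ∑ m ∈ Finset.range n, a (m + 1) = 0 := by
      rw [← hsum0, Finset.sum_range_succ' _ n]; ring
    have hlog2 : Real.log (1 / 2 : ℝ) = -Real.log 2 := by
      rw [one_div, Real.log_inv]
    rw [hlog2]
    have hexp : ∑ m ∈ Finset.range n, a (m + 1) * (Real.log ‖riemannXi ((2 * (m + 1 : ℕ) : ℝ) : ℂ)‖ - L) =
        ∑ m ∈ Finset.range n, a (m + 1) * (Real.log 2 + Real.log ‖riemannXi ((2 * (m + 1 : ℕ) : ℝ) : ℂ)‖) -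
          (Real.log 2 + L) * ∑ m ∈ Finset.range n, a (m + 1) := by
      rw [Finset.mul_sum, ← Finset.sum_sub_distrib]
      exact Finset.sum_congr rfl fun m _ ↦ by ring
    push_cast at hexp ⊢
    rw [hexp]
    linear_combination (-(Real.log 2) - L) * hsum1
  -- conclusion
  rw [← hDval]
  simpa only [hbox] using hlim

end Literature.NumberTheory.LFunctions
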